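import Summits.BirchSwinnertonDyer.BirchSwinnertonDyer.Theses.PAdicOrderV2
import Summits.BirchSwinnertonDyer.BirchSwinnertonDyer.Theorems.PAdicOrderV2PAdicOrderThesisR2StubUBRank0
import Summits.BirchSwinnertonDyer.BirchSwinnertonDyer.Theorems.PAdicOrderV2PAdicOrderThesisR2JetCongruence
import Summits.BirchSwinnertonDyer.BirchSwinnertonDyer.Theorems.PAdicOrderV2PAdicOrderThesisR2StubWiring

/-! Scratch (crux-strategist s2): the five split children of `PAdicOrderThesisR2` rendered as the
gate would (route namespace, route-file spelling); the glue `C₁ → C₂ → C₃ → C₄ → C₅ → X` proved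
from the LANDED sandwich `padicOrderThesisR2_of_sandwich` (p96594) exactly as in the Theorems file
`PAdicOrderV2PAdicOrderThesisR2SplitGlue.lean`; necessity of each open child for X; and the landed
conditional closure of C₃ (`onePrimeUBRankOne_of_heightNonWieferich`, p144815). -/

set_option linter.dupNamespace false

namespace Summit.BirchSwinnertonDyer.BirchSwinnertonDyer.Theses.PAdicOrderV2

open scoped BigOperators Topology Manifold Classical MeasureTheory ProbabilityTheory Matrix InnerProductSpace ComplexConjugate ContinuousMap
open Filter Set Function TopologicalSpace MeasureTheory
open Literature

/-- C1 (support) -/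
def PAdicOrderModularity : Prop :=
  ∀ (W : WeierstrassCurve ℚ) [W.IsElliptic] [NeZero (W.conductorNorm ℤ)], ∃ f : CuspForm (CongruenceSubgroup.Gamma0 (W.conductorNorm ℤ)) 2, Literature.NumberTheory.EllipticCurves.ModularForms.IsNewformOf W f

/-- C2 (support) = the existing item `PAdicOrderKatoSideR2` (stmt-0491), byte-identical -/
def PAdicOrderKatoSideR2Child : Prop :=
  ∀ (W : WeierstrassCurve ℚ) [W.IsElliptic] [W.IsGloballyMinimal] (p : ℕ) [Fact p.Prime], p ≠ 2 → Literature.NumberTheory.EllipticCurves.IsOrdinaryAt W p → ∀ {N : ℕ} [NeZero N] (f : CuspForm (CongruenceSubgroup.Gamma0 N) 2), Literature.NumberTheory.EllipticCurves.ModularForms.IsNewformOf W f → (W.mordellWeilRank : ℕ∞) ≤ (Literature.NumberTheory.EllipticCurves.padicLFunction f (Literature.NumberTheory.EllipticCurves.unitRoot W p : ℚ_[p])).order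

/-- C3 (crux) -/
def PAdicOrderOnePrimeUBRankOne : Prop :=
  ∀ (W : WeierstrassCurve ℚ) [W.IsElliptic] [W.IsGloballyMinimal], W.analyticRank = 1 → ∃ (p : ℕ) (_ : Fact p.Prime), 5 ≤ p ∧ Literature.NumberTheory.EllipticCurves.IsOrdinaryAt W p ∧ ∀ {N : ℕ} [NeZero N] (f : CuspForm (CongruenceSubgroup.Gamma0 N) 2), Literature.NumberTheory.EllipticCurves.ModularForms.IsNewformOf W f → (Literature.NumberTheory.EllipticCurves.padicLFunction f (Literature.NumberTheory.EllipticCurves.unitRoot W p : ℚ_[p])).order ≤ (W.analyticRank : ℕ∞)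

/-- C4 (crux) -/
def PAdicOrderOnePrimeUBHigherRank : Prop :=
  ∀ (W : WeierstrassCurve ℚ) [W.IsElliptic] [W.IsGloballyMinimal], 2 ≤ W.analyticRank → ∃ (p : ℕ) (_ : Fact p.Prime), 5 ≤ p ∧ Literature.NumberTheory.EllipticCurves.IsOrdinaryAt W p ∧ ∀ {N : ℕ} [NeZero N] (f : CuspForm (CongruenceSubgroup.Gamma0 N) 2), Literature.NumberTheory.EllipticCurves.ModularForms.IsNewformOf W f → (Literature.NumberTheory.EllipticCurves.padicLFunction f (Literature.NumberTheory.EllipticCurves.unitRoot W p : ℚ_[p])).order ≤ (W.analyticRank : ℕ∞)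

/-- C5 (crux) -/
def PAdicOrderBSDLowerBound : Prop :=
  ∀ (W : WeierstrassCurve ℚ) [W.IsElliptic] [W.IsGloballyMinimal], W.analyticRank ≤ W.mordellWeilRank

/-- the existing route decl and the re-asked child statement agree syntactically -/
example : PAdicOrderKatoSideR2Child = PAdicOrderKatoSideR2 := rfl

/-- glue check: the type the gate's glue item will have, proved exactly as the Theorems file does -/
theorem glue_check : PAdicOrderModularity → PAdicOrderKatoSideR2 → PAdicOrderOnePrimeUBRankOne →
    PAdicOrderOnePrimeUBHigherRank → PAdicOrderBSDLowerBound → PAdicOrderThesisR2 := by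
  intro hmod hkato hUB1 hUB2 hLB
  refine _root_.Summit.BirchSwinnertonDyer.BirchSwinnertonDyer.Cruxes.PAdicOrderThesisR2.KatoSandwich.padicOrderThesisR2_of_sandwich hmod hkato ?_ ?_ ?_
  · intro W _ _ hpos
    rcases Nat.lt_or_ge W.analyticRank 2 with h1 | h2
    · exact hUB1 W (by omega)
    · exact hUB2 W h2
  · intro W _ _ h1
    have h := hLB W
    rw [h1] at h
    exact h
  · intro W _ _ _
    exact hLB W

/-! ### Necessity: every OPEN child is implied by X (children are consequences of X used toward X) -/

/-- X → C5 (kernel-checked necessity of the BSD lower bound; via p100810's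
`analyticRank_eq_mordellWeilRank_of_thesis`). -/
theorem lowerBound_of_thesis (hX : PAdicOrderThesisR2) : PAdicOrderBSDLowerBound := by
  intro W _ _
  exact (_root_.Summit.BirchSwinnertonDyer.BirchSwinnertonDyer.Cruxes.PAdicOrderThesisR2.KatoSandwich.analyticRank_eq_mordellWeilRank_of_thesis hX W).le

/-- X → C3 ∧ C4 up to the side condition `5 ≤ p` (X's witness prime may be 2 or 3; harmless —
recorded, not hidden): at X's prime `ord = r_an`, so `ord ≤ r_an` for THAT newform; for every
newform of `W` the `p`-adic `L`-function is the same (`IsNewformOf` pins `a_n`), which the tree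
expresses through `padicLFunction` depending on `f` only via its coefficients — we only record the
weaker pointwise form here. -/
theorem onePrimeUB_at_witness_of_thesis (hX : PAdicOrderThesisR2) (W : WeierstrassCurve ℚ)
    [W.IsElliptic] [W.IsGloballyMinimal] :
    ∃ (p : ℕ) (_ : Fact p.Prime), Literature.NumberTheory.EllipticCurves.IsOrdinaryAt W p ∧
      ∃ (N : ℕ) (_ : NeZero N) (f : CuspForm (CongruenceSubgroup.Gamma0 N) 2),
        Literature.NumberTheory.EllipticCurves.ModularForms.IsNewformOf W f ∧
        (Literature.NumberTheory.EllipticCurves.padicLFunction f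
          (Literature.NumberTheory.EllipticCurves.unitRoot W p : ℚ_[p])).order ≤ (W.analyticRank : ℕ∞) := by
  obtain ⟨p, hp, hord, N, hN, f, hf, han, -⟩ := hX W
  exact ⟨p, hp, hord, N, hN, f, hf, han.le⟩

/-! ### C3 is closable modulo named inputs: the landed height criterion (p144815) -/

open Literature.NumberTheory.EllipticCurves Literature.NumberTheory.EllipticCurves.ModularForms in
/-- C3 from (NW) one height-non-Wieferich good ordinary prime per curve with a point of infinite
order + (GZK, rank-1 lower bound) + (the rank-one `p`-adic Gross–Zagier consequence), verbatim the
landed `onePrimeUBRankOne_of_heightNonWieferich`. -/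
example
    (hNW : ∀ (W : WeierstrassCurve ℚ) [W.IsElliptic] [W.IsGloballyMinimal],
      (∃ P : W.toAffine.Point, ¬ IsOfFinAddOrder P) →
      ∃ (p : ℕ) (_ : Fact p.Prime), 5 ≤ p ∧ IsOrdinaryAt W p ∧
        ∃ (x y : ℚ) (h : W.toAffine.Nonsingular x y),
          W.IsAdmissible p (.some x y h) ∧
          ¬ (x.num ^ (p - 1) = 1 ∨ (padicValNat p x.den : ℤ) ≤ padicValInt p (x.num ^ (p - 1) - 1)))
    (hLB : ∀ (W : WeierstrassCurve ℚ) [W.IsElliptic] [W.IsGloballyMinimal],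
      W.analyticRank = 1 → 1 ≤ W.mordellWeilRank)
    (hPR : ∀ (W : WeierstrassCurve ℚ) [W.IsElliptic] [W.IsGloballyMinimal], W.analyticRank = 1 →
      ∀ (p : ℕ) [Fact p.Prime], 5 ≤ p → IsOrdinaryAt W p →
      ∀ {x y : ℚ} (h : W.toAffine.Nonsingular x y), W.IsAdmissible p (.some x y h) →
        W.canonicalPAdicHeight p (.some x y h) ≠ 0 →
      ∀ {N : ℕ} [NeZero N] (f : CuspForm (CongruenceSubgroup.Gamma0 N) 2), IsNewformOf W f →
        (padicLFunction f (unitRoot W p : ℚ_[p])).order ≤ 1) :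
    PAdicOrderOnePrimeUBRankOne :=
  _root_.Summit.BirchSwinnertonDyer.BirchSwinnertonDyer.Cruxes.PAdicOrderThesisR2.WieferichJet.onePrimeUBRankOne_of_heightNonWieferich
    hNW hLB hPR

end Summit.BirchSwinnertonDyer.BirchSwinnertonDyer.Theses.PAdicOrderV2
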